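import Summits.ResolutionOfSingularities.ResolutionOfSingularities.Theorems.ValuativeLuAlphaPTorsorAdaptedValueStepValues
import Summits.ResolutionOfSingularities.ResolutionOfSingularities.Theorems.ValuativeLuAlphaPTorsorTowerStep
import Mathlib.RingTheory.Valuation.ValuationSubring
import Mathlib.Algebra.MvPolynomial.CommRing
import Mathlib.Data.Finsupp.Weight
import HarnessLib

/-!
# Adapted value step, II: the relative `𝔭`-adic expansion at a level

Crux `Valuative.LuAlphaPTorsor` (stmt-ResolutionOfSingularities-0641), line `pfaff-line-log-final-forms`,
registered stub `stub_adaptedValueStep` (F6v, wave 2: the ADAPTED value step of the purely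
inseparable tower, any rank) — helper file 2/8.

For a chart `(R, x, lv)` satisfying clause (C3) of `AdaptedChart` (the parameters of level `≥ ℓ`
generate the ideal of elements smaller than every Laurent monomial of the levels `< ℓ`):
membership in these level ideals as explicit combinations, smallness calculus, and the
RELATIVE `𝔭`-ADIC EXPANSION at level `ℓ` (`adValue_rel_expansion`): every `r ∈ R` is, up to an
element smaller than every monomial of the levels `≤ ℓ`, a polynomial in the parameters of level
`ℓ` with coefficients in `R` whose coefficients in degree `< N` are not small below level `ℓ`
(the analogue of S3's `perron_exists_expansion`, one level at a time). [folklore]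
-/

noncomputable section

-- `Summit.<S>.<S>.…` duplicates the summit name by design (D-0017, single-problem summit).
set_option linter.dupNamespace false

open IsLocalRing

namespace Summit.ResolutionOfSingularities.ResolutionOfSingularities.Theorems.PfaffLine

open Literature.AlgebraicGeometry.Resolution

section ClaimC

variable {k K : Type} [Field k] [Field K] [Algebra k K] (O : ValuationSubring K) {n : ℕ}
  (R : Subalgebra k K) (hRO : R.toSubring ≤ O.toSubring) (x : Fin n → K) (hx : ∀ i, x i ∈ R)
  (lv : Fin n → ℕ)

/-- Membership in the ideal of the parameters of level `≥ ℓ`, as an explicit combination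
`∑ xᵢ dᵢ` with `dᵢ ∈ R` vanishing on the levels `< ℓ`. -/
theorem adValue_mem_levelIdeal_iff (ℓ : ℕ) {r : K} (hr : r ∈ R) :
    (⟨r, hr⟩ : R.toSubring) ∈ Ideal.span (Set.range
        fun i : {i : Fin n // ℓ ≤ lv i} => (⟨x i.1, hx i.1⟩ : R.toSubring)) ↔
      ∃ d : Fin n → K, (∀ i, d i ∈ R) ∧ (∀ i, lv i < ℓ → d i = 0) ∧ r = ∑ i, x i * d i := by
  classical
  constructor
  · intro h
    obtain ⟨c, hc⟩ := Ideal.mem_span_range_iff_exists_fun.mp h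
    set d : Fin n → K := fun i => if hi : ℓ ≤ lv i then (c ⟨i, hi⟩ : K) else 0 with hd
    have hdR : ∀ i, d i ∈ R := fun i => by
      by_cases hi : ℓ ≤ lv i
      · simp only [hd, dif_pos hi]; exact (c ⟨i, hi⟩).2
      · simp only [hd, dif_neg hi]; exact R.zero_mem
    have hd0 : ∀ i, lv i < ℓ → d i = 0 := fun i hi => by
      simp only [hd, dif_neg (not_le.mpr hi)]
    refine ⟨d, hdR, hd0, ?_⟩
    have h1 := congrArg Subtype.val hc
    push_cast at h1
    rw [← h1]
    symm
    calc ∑ i, x i * d i = ∑ i ∈ Finset.univ.filter (fun i => ℓ ≤ lv i), x i * d i := by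
          refine (Finset.sum_filter_of_ne fun i _ hi => ?_).symm
          by_contra hle
          exact hi (by rw [hd0 i (not_le.mp hle), mul_zero])
      _ = ∑ a : {i : Fin n // ℓ ≤ lv i}, x a.1 * d a.1 :=
          Finset.sum_subtype (p := fun i => ℓ ≤ lv i) _ (by simp) (fun i => x i * d i)
      _ = ∑ a : {i : Fin n // ℓ ≤ lv i}, (c a : K) * x a.1 :=
          Fintype.sum_congr _ _ fun a => by simp only [hd, dif_pos a.2]; ring
  · rintro ⟨d, hdR, hd0, hrd⟩
    have heq : (⟨r, hr⟩ : R.toSubring) =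
        ∑ i, (⟨x i, hx i⟩ : R.toSubring) * (⟨d i, hdR i⟩ : R.toSubring) :=
      Subtype.ext (by push_cast; exact hrd)
    rw [heq]
    refine Ideal.sum_mem _ fun i _ => ?_
    by_cases hi : ℓ ≤ lv i
    · exact Ideal.mul_mem_right _ _ (Ideal.subset_span ⟨⟨i, hi⟩, rfl⟩)
    · have : (⟨d i, hdR i⟩ : R.toSubring) = 0 := Subtype.ext (hd0 i (not_le.mp hi))
      rw [this, mul_zero]
      exact Ideal.zero_mem _

variable (hx0 : ∀ i, x i ≠ 0)
  (hC2a : ∀ i i', lv i < lv i' → ∀ m : Fin n → ℤ, (∀ j, lv i < lv j → m j = 0) →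
    O.valuation (x i') < ∏ j, O.valuation (x j) ^ (m j))
  (hC3 : ∀ (ℓ : ℕ) (z : R.toSubring),
    z ∈ Ideal.span (Set.range fun i : {i : Fin n // ℓ ≤ lv i} => (⟨x i.1, hx i.1⟩ : R.toSubring)) ↔
      ∀ m : Fin n → ℤ, (∀ j, ℓ ≤ lv j → m j = 0) →
        O.valuation (z : K) < ∏ j, O.valuation (x j) ^ (m j))

include hC3 in
/-- The parameters of an adapted chart have value `< 1` ((C3) at level `0`). -/
theorem adValue_param_lt_one (i : Fin n) : O.valuation (x i) < 1 := by
  have h := (hC3 0 ⟨x i, hx i⟩).mp (Ideal.subset_span ⟨⟨i, Nat.zero_le _⟩, rfl⟩) 0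
    fun _ _ => rfl
  simpa using h

include hC2a hC3 in
/-- A parameter of level `≥ b` is smaller than every Laurent monomial supported on levels `< b`. -/
theorem adValue_param_small (b : ℕ) (i : Fin n) (hi : b ≤ lv i) (m : Fin n → ℤ)
    (hm : ∀ j, b ≤ lv j → m j = 0) : O.valuation (x i) < ∏ j, O.valuation (x j) ^ (m j) :=
  adValue_lt_lower (fun i => O.valuation (x i)) lv hC2a (adValue_param_lt_one O R x hx lv hC3)
    i m fun j hj => hm j (hi.trans hj)

include hx0 in
/-- Smallness below level `b` is preserved by sums. -/
theorem adValue_small_sum {ι : Type} (s : Finset ι) (f : ι → K) (b : ℕ)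
    (hf : ∀ a ∈ s, ∀ m : Fin n → ℤ, (∀ j, b ≤ lv j → m j = 0) →
      O.valuation (f a) < ∏ j, O.valuation (x j) ^ (m j)) :
    ∀ m : Fin n → ℤ, (∀ j, b ≤ lv j → m j = 0) →
      O.valuation (∑ a ∈ s, f a) < ∏ j, O.valuation (x j) ^ (m j) := fun m hm =>
  Valuation.map_sum_lt _ (Finset.prod_ne_zero_iff.mpr fun j _ =>
    zpow_ne_zero _ ((map_ne_zero _).mpr (hx0 j))) fun a ha => hf a ha m hm

/-- Smallness below level `b` is preserved by multiplication with elements of `O`. -/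
theorem adValue_small_mul {z a : K} (ha : O.valuation a ≤ 1) (b : ℕ)
    (hz : ∀ m : Fin n → ℤ, (∀ j, b ≤ lv j → m j = 0) →
      O.valuation z < ∏ j, O.valuation (x j) ^ (m j)) :
    ∀ m : Fin n → ℤ, (∀ j, b ≤ lv j → m j = 0) →
      O.valuation (z * a) < ∏ j, O.valuation (x j) ^ (m j) := fun m hm => by
  rw [map_mul]
  exact lt_of_le_of_lt (mul_le_of_le_one_right' ha) (hz m hm)

include hRO hx0 hC2a hC3 in
/-- **Relative `𝔭`-adic expansion at level `ℓ`.** Every `r ∈ R` is, modulo an element which is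
smaller than every Laurent monomial of the levels `≤ ℓ`, a polynomial in the parameters of
level `ℓ` with coefficients in `R` whose coefficients in degree `< N` are NOT smaller than
every Laurent monomial of the levels `< ℓ`. -/
theorem adValue_rel_expansion (ℓ N : ℕ) {r : K} (hr : r ∈ R) :
    ∃ P : MvPolynomial (Fin n) K, (∀ μ, P.coeff μ ∈ R) ∧
      (∀ μ ∈ P.support, ∀ j, lv j ≠ ℓ → μ j = 0) ∧
      (∀ μ ∈ P.support, Finsupp.degree μ < N → ∃ m : Fin n → ℤ, (∀ j, ℓ ≤ lv j → m j = 0) ∧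
        (∏ j, O.valuation (x j) ^ (m j)) ≤ O.valuation (P.coeff μ)) ∧
      ∀ m : Fin n → ℤ, (∀ j, ℓ < lv j → m j = 0) →
        O.valuation (r - MvPolynomial.eval x P) < ∏ j, O.valuation (x j) ^ (m j) := by
  classical
  have hv0 : ∀ m : Fin n → ℤ, (∏ j, O.valuation (x j) ^ (m j)) ≠ 0 := fun m =>
    Finset.prod_ne_zero_iff.mpr fun j _ => zpow_ne_zero _ ((map_ne_zero _).mpr (hx0 j))
  induction N with
  | zero =>
    refine ⟨MvPolynomial.C r, fun μ => ?_, fun μ hμ j _ => ?_, fun μ _ h => (Nat.not_lt_zero _ h).elim,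
      fun m _ => ?_⟩
    · rw [MvPolynomial.coeff_C]
      split_ifs
      · exact hr
      · exact R.zero_mem
    · rw [MvPolynomial.mem_support_iff, MvPolynomial.coeff_C] at hμ
      split_ifs at hμ with h
      · rw [← h]; rfl
      · exact (hμ rfl).elim
    · rw [MvPolynomial.eval_C, sub_self, map_zero]
      exact zero_lt_iff.mpr (hv0 m)
  | succ N ih =>
    obtain ⟨P, hPR, hPs, hPv, hPe⟩ := ih
    -- the exponents of degree `N` with a SMALL coefficient
    set T : Finset (Fin n →₀ ℕ) := P.support.filter fun μ => Finsupp.degree μ = N ∧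
      ¬ ∃ m : Fin n → ℤ, (∀ j, ℓ ≤ lv j → m j = 0) ∧
        (∏ j, O.valuation (x j) ^ (m j)) ≤ O.valuation (P.coeff μ) with hT
    have hd : ∀ μ : Fin n →₀ ℕ, ∃ d : Fin n → K, μ ∈ T →
        (∀ i, d i ∈ R) ∧ (∀ i, lv i < ℓ → d i = 0) ∧ P.coeff μ = ∑ i, x i * d i := by
      intro μ
      by_cases hμ : μ ∈ T
      · have hsmall := (Finset.mem_filter.mp hμ).2.2
        push Not at hsmall
        have hmem : (⟨P.coeff μ, hPR μ⟩ : R.toSubring) ∈ Ideal.span (Set.range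
            fun i : {i : Fin n // ℓ ≤ lv i} => (⟨x i.1, hx i.1⟩ : R.toSubring)) :=
          (hC3 ℓ _).mpr fun m hm => hsmall m hm
        obtain ⟨d, hdR, hd0, hdeq⟩ := (adValue_mem_levelIdeal_iff R x hx lv ℓ (hPR μ)).mp hmem
        exact ⟨d, fun _ => ⟨hdR, hd0, hdeq⟩⟩
      · exact ⟨0, fun h => (hμ h).elim⟩
    choose d hd using hd
    have hevalA : ∀ (μ : Fin n →₀ ℕ) (c : K),
        MvPolynomial.eval x (MvPolynomial.monomial μ c) = c * ∏ j, x j ^ (μ j) := by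
      intro μ c
      rw [MvPolynomial.eval_monomial, Finsupp.prod_pow]
    -- level-`ℓ` part goes back into the polynomial, the higher part into the remainder
    set P' : MvPolynomial (Fin n) K :=
      P - ∑ μ ∈ T, MvPolynomial.monomial μ (P.coeff μ) +
        ∑ μ ∈ T, ∑ i ∈ Finset.univ.filter (fun i => lv i = ℓ),
          MvPolynomial.monomial (μ + Finsupp.single i 1) (d μ i) with hP'
    have hcoeff : ∀ ν, P'.coeff ν = P.coeff ν - (if ν ∈ T then P.coeff ν else 0) +
        ∑ μ ∈ T, ∑ i ∈ Finset.univ.filter (fun i => lv i = ℓ),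
          (if μ + Finsupp.single i 1 = ν then d μ i else 0) := by
      intro ν
      simp only [hP', MvPolynomial.coeff_add, MvPolynomial.coeff_sub, MvPolynomial.coeff_sum,
        MvPolynomial.coeff_monomial, Finset.sum_ite_eq']
    have hsum0 : ∀ ν : Fin n →₀ ℕ, Finsupp.degree ν ≤ N →
        (∑ μ ∈ T, ∑ i ∈ Finset.univ.filter (fun i => lv i = ℓ),
          (if μ + Finsupp.single i 1 = ν then d μ i else (0 : K))) = 0 := by
      intro ν hν
      refine Finset.sum_eq_zero fun μ hμ => Finset.sum_eq_zero fun i _ => ?_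
      rw [if_neg]
      rintro rfl
      rw [map_add, Finsupp.degree_single, (Finset.mem_filter.mp hμ).2.1] at hν
      omega
    refine ⟨P', fun ν => ?_, fun ν hν j hj => ?_, fun ν hν hdeg => ?_, ?_⟩
    · -- coefficients in `R`
      rw [hcoeff]
      refine add_mem (sub_mem (hPR ν) ?_) (sum_mem fun μ hμ => sum_mem fun i _ => ?_)
      · split_ifs
        · exact hPR ν
        · exact R.zero_mem
      · split_ifs
        · exact ((hd μ) hμ).1 i
        · exact R.zero_mem
    · -- support on level `ℓ`
      have hν0 : P'.coeff ν ≠ 0 := MvPolynomial.mem_support_iff.mp hν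
      rw [hcoeff] at hν0
      by_cases hP0 : P.coeff ν = 0
      · rw [hP0] at hν0
        simp only [ite_self, sub_zero, zero_add] at hν0
        obtain ⟨μ, hμ, hμne⟩ := Finset.exists_ne_zero_of_sum_ne_zero hν0
        obtain ⟨i, hi, hine⟩ := Finset.exists_ne_zero_of_sum_ne_zero hμne
        rw [Finset.mem_filter] at hi
        split_ifs at hine with heq
        · rw [← heq, Finsupp.add_apply, hPs μ (Finset.mem_filter.mp hμ).1 j hj,
            Finsupp.single_apply, if_neg (fun h => hj (by rw [← h]; exact hi.2)), add_zero]
        · exact (hine rfl).elim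
      · exact hPs ν (MvPolynomial.mem_support_iff.mpr hP0) j hj
    · -- big coefficients below degree `N + 1`
      have hν0 : P'.coeff ν ≠ 0 := MvPolynomial.mem_support_iff.mp hν
      have hdeg' : Finsupp.degree ν ≤ N := Nat.lt_succ_iff.mp hdeg
      rw [hcoeff, hsum0 ν hdeg', add_zero] at hν0 ⊢
      rcases hdeg'.lt_or_eq with hlt | heq
      · have hνT : ν ∉ T := fun h => by
          have := (Finset.mem_filter.mp h).2.1
          omega
        rw [if_neg hνT, sub_zero] at hν0 ⊢
        exact hPv ν (MvPolynomial.mem_support_iff.mpr hν0) hlt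
      · by_cases hνT : ν ∈ T
        · rw [if_pos hνT, sub_self] at hν0
          exact (hν0 rfl).elim
        · rw [if_neg hνT, sub_zero] at hν0 ⊢
          by_contra hbig
          exact hνT (Finset.mem_filter.mpr ⟨MvPolynomial.mem_support_iff.mpr hν0, heq, hbig⟩)
    · -- the new remainder is small below level `ℓ + 1`
      have hevalB : ∀ μ ∈ T, MvPolynomial.eval x (MvPolynomial.monomial μ (P.coeff μ)) =
          (∑ i ∈ Finset.univ.filter (fun i => lv i = ℓ),
            MvPolynomial.eval x (MvPolynomial.monomial (μ + Finsupp.single i 1) (d μ i))) +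
          (∏ j, x j ^ (μ j)) * ∑ i ∈ Finset.univ.filter (fun i => ¬ lv i = ℓ), x i * d μ i := by
        intro μ hμ
        rw [hevalA, ((hd μ) hμ).2.2, mul_comm,
          ← Finset.sum_filter_add_sum_filter_not Finset.univ (fun i => lv i = ℓ), mul_add,
          Finset.mul_sum]
        congr 1
        refine Finset.sum_congr rfl fun i _ => ?_
        rw [MvPolynomial.monomial_add_single, map_mul, map_pow, hevalA, MvPolynomial.eval_X]
        ring
      have hre : r - MvPolynomial.eval x P' = (r - MvPolynomial.eval x P) +
          ∑ μ ∈ T, (∏ j, x j ^ (μ j)) *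
            ∑ i ∈ Finset.univ.filter (fun i => ¬ lv i = ℓ), x i * d μ i := by
        rw [hP']
        simp only [map_add, map_sub, map_sum]
        rw [Finset.sum_congr rfl hevalB, Finset.sum_add_distrib]
        ring
      rw [hre]
      intro m hm
      refine Valuation.map_add_lt _ (hPe m hm) ?_
      refine adValue_small_sum O x lv hx0 _ _ (ℓ + 1) (fun μ hμ m hm => ?_) m hm
      rw [mul_comm]
      refine adValue_small_mul O x lv ((O.valuation_le_one_iff _).mpr
        (hRO (R.prod_mem fun j _ => R.pow_mem (hx j) _))) (ℓ + 1) (fun m hm => ?_) m hm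
      refine adValue_small_sum O x lv hx0 _ _ (ℓ + 1) (fun i hi m hm => ?_) m hm
      have hiℓ : lv i ≠ ℓ := (Finset.mem_filter.mp hi).2
      rcases lt_or_gt_of_ne hiℓ with hlt | hgt
      · rw [((hd μ) hμ).2.1 i hlt, mul_zero, map_zero]
        exact zero_lt_iff.mpr (hv0 m)
      · exact adValue_small_mul O x lv ((O.valuation_le_one_iff _).mpr (hRO (((hd μ) hμ).1 i)))
          (ℓ + 1) (adValue_param_small O R x hx lv hC2a hC3 (ℓ + 1) i hgt) m hm

end ClaimC

/-- Registered anchor of this helper file: smallness below a level is stable under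
multiplication by elements of `O`. -/
theorem adValue_anchor_expansion : ∀ (K : Type) [Field K] (O : ValuationSubring K) (n : ℕ) (x : Fin n → K) (lv : Fin n → ℕ) (b : ℕ) (z a : K), O.valuation a ≤ 1 → (∀ m : Fin n → ℤ, (∀ j, b ≤ lv j → m j = 0) → O.valuation z < ∏ j, O.valuation (x j) ^ (m j)) → ∀ m : Fin n → ℤ, (∀ j, b ≤ lv j → m j = 0) → O.valuation (z * a) < ∏ j, O.valuation (x j) ^ (m j) := by
  intro K _ O n x lv b z a ha hz
  exact adValue_small_mul O x lv ha b hz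

end Summit.ResolutionOfSingularities.ResolutionOfSingularities.Theorems.PfaffLine

end
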